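import Summits.Ventures.YMGap.RobustBall.LoopActionGaugeBall
import Summits.Ventures.YMGap.RobustBall.ShapeLoopFamilyFR
import Summits.Ventures.YMGap.RobustBall.MassGapOnBallZdGRowsSUN
import HarnessLib

/-!
# Venture YMGap, track ROBUST-BALL (tier 1) — finite-range loop actions on `ℤ³` through the robust vertex-star door:
# `SU(2)` cells up to `β_W = 1/2`

HONEST FRAMING. WHAT THIS IS: a venture file (cell `pub-ymgap`, track Y2 ROBUST-BALL, seat rb-p1): ds-2's `ℤ³` star-door cells on the
gauge-invariant ball (`MassGapOnBallZdGRowsSUN.lean`: `su2_massGapOnBallZdG_dim3_star_*`, class K, hypothesis-free) read on FINITE-RANGE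
generic Wilson-type loop actions on `ℤ³` through `memBallZdG_loopFamilyAction` (loads `(2ε, 3ε)` on `ℤ³`): `SU(2)`, `d = 3`, finite carrier
fibres, finitely many loops per link, extent `≤ R`, `‖c‖₀ ≤ ε` ⇒ unique DLR state with exponential clustering at
`(β_W, ε) = (1/4, .038), (3/10, .03), (2/5, 1/60), (1/2, 17/3000)` — the three-dimensional lattice of the cell's `YM₃` lane; instances: all
closed trails of length `≤ L₀`, finitely many shapes. WHAT IT IS NOT: no new door or number; strong-coupling lattice statements; nothing
about the continuum limit or the Clay problem.

References: ds-2 `MassGapOnBallZdGRowsSUN.lean`, `RobustStarDoorZd.lean`; this track's `LoopActionGaugeBall.lean`, `ShapeLoopFamilyFR.lean`.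
-/

noncomputable section

open MeasureTheory Function Real SimpleGraph
open Literature.Probability.LatticeModels
open Literature.MathematicalPhysics.QuantumLattice
open Literature.MathematicalPhysics.QuantumFieldTheory (walkEdges)

namespace Summit.Ventures.YMGap.RobustBall

variable {ι : Type*} {γ : ι → ZdLoop 3} {c : ι → ℝ} {R : ℕ}

/-- **`SU(2)`, `d = 3`, `β_W = 1/4` (slot `1/16`), star door**: finite-range loop actions with `‖c‖₀ ≤ 0.038`
(cell `su2_massGapOnBallZdG_dim3_star_oneQuarter`, loads `(57/250, 57/500)`). -/
theorem su2_dim3_loopFamilyStar_massGapS_1_4 (hfin : ∀ X, {i | walkEdges (γ i).walk = X}.Finite)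
    (hthr : ∀ e : ZdEdge 3, {i | e ∈ walkEdges (γ i).walk}.Finite)
    (hR : ∀ i, ∀ e ∈ walkEdges (γ i).walk, ∀ y ∈ walkEdges (γ i).walk, ‖e.1 - y.1‖ ≤ (R : ℝ))
    (h : LoopNormLE 0 γ c (19 / 500)) : PerturbedMassGapAtS 3 2 (1 / 16) (loopFamilyAction (d := 3) 2 γ c) :=
  perturbedMassGapAtS_loopFamilyAction_of_gaugeBall (ε := 19 / 500)
    ((su2_massGapOnBallZdG_dim3_star_oneQuarter R).mono (by norm_num) (by norm_num) le_rfl) hfin hthr hR h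

/-- **`SU(2)`, `d = 3`, `β_W = 3/10` (slot `3/40`), star door**: `‖c‖₀ ≤ 0.03`. -/
theorem su2_dim3_loopFamilyStar_massGapS_3_10 (hfin : ∀ X, {i | walkEdges (γ i).walk = X}.Finite)
    (hthr : ∀ e : ZdEdge 3, {i | e ∈ walkEdges (γ i).walk}.Finite)
    (hR : ∀ i, ∀ e ∈ walkEdges (γ i).walk, ∀ y ∈ walkEdges (γ i).walk, ‖e.1 - y.1‖ ≤ (R : ℝ))
    (h : LoopNormLE 0 γ c (3 / 100)) : PerturbedMassGapAtS 3 2 (3 / 40) (loopFamilyAction (d := 3) 2 γ c) :=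
  perturbedMassGapAtS_loopFamilyAction_of_gaugeBall (ε := 3 / 100)
    ((su2_massGapOnBallZdG_dim3_star_threeTenths R).mono (by norm_num) (by norm_num) le_rfl) hfin hthr hR h

/-- **`SU(2)`, `d = 3`, `β_W = 2/5` (slot `1/10`), star door**: `‖c‖₀ ≤ 1/60`. -/
theorem su2_dim3_loopFamilyStar_massGapS_2_5 (hfin : ∀ X, {i | walkEdges (γ i).walk = X}.Finite)
    (hthr : ∀ e : ZdEdge 3, {i | e ∈ walkEdges (γ i).walk}.Finite)
    (hR : ∀ i, ∀ e ∈ walkEdges (γ i).walk, ∀ y ∈ walkEdges (γ i).walk, ‖e.1 - y.1‖ ≤ (R : ℝ))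
    (h : LoopNormLE 0 γ c (1 / 60)) : PerturbedMassGapAtS 3 2 (1 / 10) (loopFamilyAction (d := 3) 2 γ c) :=
  perturbedMassGapAtS_loopFamilyAction_of_gaugeBall (ε := 1 / 60)
    ((su2_massGapOnBallZdG_dim3_star_twoFifths R).mono (by norm_num) (by norm_num) le_rfl) hfin hthr hR h

/-- **`SU(2)`, `d = 3`, `β_W = 1/2` (slot `1/8`), star door**: `‖c‖₀ ≤ 17/3000` — the furthest coupling on `ℤ³` with a certified
loop-action ball. -/
theorem su2_dim3_loopFamilyStar_massGapS_1_2 (hfin : ∀ X, {i | walkEdges (γ i).walk = X}.Finite)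
    (hthr : ∀ e : ZdEdge 3, {i | e ∈ walkEdges (γ i).walk}.Finite)
    (hR : ∀ i, ∀ e ∈ walkEdges (γ i).walk, ∀ y ∈ walkEdges (γ i).walk, ‖e.1 - y.1‖ ≤ (R : ℝ))
    (h : LoopNormLE 0 γ c (17 / 3000)) : PerturbedMassGapAtS 3 2 (1 / 8) (loopFamilyAction (d := 3) 2 γ c) :=
  perturbedMassGapAtS_loopFamilyAction_of_gaugeBall (ε := 17 / 3000)
    ((su2_massGapOnBallZdG_dim3_star_oneHalf R).mono (by norm_num) (by norm_num) le_rfl) hfin hthr hR h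

/-! ### Instances on `ℤ³` -/

/-- **`SU(2)`, `d = 3`, `β_W = 1/4` — all closed trails of `ℤ³` of length `≤ L₀` with `∑_{γ ∋ e} |c_γ| |γ| ≤ 0.038`.** -/
theorem su2_dim3_trailsLEStar_massGapS_1_4 (L₀ : ℕ) {c : TrailIdxLE 3 L₀ → ℝ} (h : LoopNormLE 0 (trailLoopLE L₀) c (19 / 500)) :
    PerturbedMassGapAtS 3 2 (1 / 16) (loopFamilyAction (d := 3) 2 (trailLoopLE L₀) c) :=
  su2_dim3_loopFamilyStar_massGapS_1_4 (R := 2 * L₀) finite_fibre_trailLoopLE finite_through_trailLoopLE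
    (fun i e he y hy => by exact_mod_cast norm_sub_le_trailLoopLE i e he y hy) h

/-- **`SU(2)`, `d = 3`, `β_W = 1/2` — all closed trails of `ℤ³` of length `≤ L₀` with `‖c‖₀ ≤ 17/3000`.** -/
theorem su2_dim3_trailsLEStar_massGapS_1_2 (L₀ : ℕ) {c : TrailIdxLE 3 L₀ → ℝ} (h : LoopNormLE 0 (trailLoopLE L₀) c (17 / 3000)) :
    PerturbedMassGapAtS 3 2 (1 / 8) (loopFamilyAction (d := 3) 2 (trailLoopLE L₀) c) :=
  su2_dim3_loopFamilyStar_massGapS_1_2 (R := 2 * L₀) finite_fibre_trailLoopLE finite_through_trailLoopLE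
    (fun i e he y hy => by exact_mod_cast norm_sub_le_trailLoopLE i e he y hy) h

/-- **`SU(2)`, `d = 3`, `β_W = 1/4` — any FINITE set of loop shapes on `ℤ³` translated everywhere with `∑_s |c₀ s| |σ s|² ≤ 0.038`.** -/
theorem su2_dim3_finiteShapesStar_massGapS_1_4 {S : Type*} [Fintype S] {σ : S → (zdGraph 3).Walk (0 : Site 3) 0}
    (hpos : ∀ s, 0 < (σ s).length) (hRσ : ∀ s, ∀ e ∈ walkEdges (σ s), ∀ y ∈ walkEdges (σ s), ‖e.1 - y.1‖ ≤ (R : ℝ))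
    {c₀ : S → ℝ} (hε : ∑ s, |c₀ s| * ((σ s).length : ℝ) ^ 2 ≤ 19 / 500) :
    PerturbedMassGapAtS 3 2 (1 / 16) (loopFamilyAction (d := 3) 2 (shapeLoop σ) fun i => c₀ i.2) := by
  have hR' : ∀ i : Site 3 × S, ∀ e ∈ walkEdges (shapeLoop σ i).walk, ∀ y ∈ walkEdges (shapeLoop σ i).walk,
      ‖e.1 - y.1‖ ≤ (R : ℝ) := by
    intro i e he y hy
    have h := hRσ i.2 _ ((mem_walkEdges_shapeLoop_iff σ i e).1 he) _ ((mem_walkEdges_shapeLoop_iff σ i y).1 hy)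
    simpa [sub_sub_sub_cancel_right] using h
  have hn : LoopNormLE 0 (shapeLoop σ) (fun i => c₀ i.2) (19 / 500) := loopNormLE_zero_shapeLoop hRσ hε
  exact su2_dim3_loopFamilyStar_massGapS_1_4 (finite_fibre_shapeLoop σ finite_fibre_of_finite_shapes hpos)
    (finite_through_shapeLoop σ) hR' hn

end Summit.Ventures.YMGap.RobustBall

end
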